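import Summits.ResolutionOfSingularities.ResolutionOfSingularities.Theorems.FrobeniusClosingSteerHullVocabulary
import HarnessLib

/-!
# Crux `Steer` (stmt-ResolutionOfSingularities-16345), chain W4.1, NSCᴹ line — **HULL VOCABULARY, PROVED PIECES**
# (near monomial reach = HLOST Prop. 4.4; far-regular exit; `T = S[1/x]`; near ⟺ unit of the hull)

OURS (campaign `res-hironaka`, rung L ★L-G4, slot W4.1; seat res-type-028, res-L0-w41-plan-1's UNCLAIMED-STUB LIST
2026-08-27T08:41:57Z item **U2 «NSCᴹ-VOCAB HOIST»**, companion of the definition file `FrobeniusClosingSteerHullVocabulary.lean`;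
NOT a statement of the manuscript under review [claim: Hironaka2017, status: under-review]; AI-produced, weaker than expert review).
Theses-free, definition-free.

* §A `T = S[1/x]` both ways (`hullRing_le_noethHull`), «near ⟺ unit of the hull» (`IsNear.isUnit_hullRing`,
  `isNear_of_inv_mem_hullRing`), products of monomial × unit presentations on a common parameter part.
* §B **`nearMonomialReach_holds`** — the TYPE is the literal body of res-L0-w41-idea-2's `def Idea2g4.NearMonomialReach : Prop`
  (`L/res-L0-w41-idea-2/Sketch-idea-2f.lean` 64403cb98dc5de30 l.654), so the sketch's / the skeleton's Prop closes by
  `exact Hull.nearMonomialReach_holds`: a NEAR element of the Shannon extension of the point sequence of a base regular at the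
  centre of `O` is monomial × unit at some member (HLOST Prop. 4.4 made elementary: the hull parameter is a regular parameter
  of some member, hence monomial × unit at every later member by the tree's `exists_monomial_along` ∘ `stub_rsopMonomialStep`
  = HLOST Lemma 2.7, and a divisor of a monomial × unit in a regular local ring is one, `exists_monomial_of_mul_eq`); engine
  `exists_monomialUnitAt_of_mul_eq_pow`, unbundled `IsNear.exists_monomialUnitAt`, persistence `MonomialUnitAt.along`.
* §C **`farRegularExit`** (sketch l.904): `f = e · w`, `e` an E-1 monomial × unit in near members `y`,
  `w` completing `y` to a part of a regular system of parameters ⇒ `f` toroidal with exponent `1` on `w`.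

Sources: [HeinzerEtAl2015] Lemma 2.7, Thm. 4.1, Prop. 4.4; [Shannon1973]. No named facts, no `sorry`.
-/

noncomputable section

-- `Summit.<S>.<S>.…` duplicates the summit name by design (single-problem summit).
set_option linter.dupNamespace false
set_option autoImplicit false

namespace Summit.ResolutionOfSingularities.ResolutionOfSingularities.Theorems.SwitchingDichotomy.Hull

open IsLocalRing
open Literature.AlgebraicGeometry.Resolution

variable {k K : Type} [Field k] [Field K] [Algebra k K]

/-! ## §A The hull as `S[1/x]`; near ⟺ unit of the hull -/

/-- For `x ∈ S`, the subring hull is contained in the set-hull (so the two agree): `S[x⁻¹] ⊆ {s / x^m}`.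
OURS. [folklore] -/
theorem hullRing_le_noethHull (R : ℕ → Subring K) (x : K) (hx : x ∈ shannonExt R) (hx0 : x ≠ 0) :
    (hullRing R x : Set K) ⊆ noethHull R x := by
  intro y hy
  refine Subring.closure_induction (fun z hz => ?_) ?_ ?_ ?_ ?_ ?_ hy
  · rcases hz with hz | hz
    · exact ⟨0, z, hz, by rw [pow_zero, div_one]⟩
    · refine ⟨1, 1, Subring.one_mem _, ?_⟩
      rw [Set.mem_singleton_iff.mp hz, pow_one, one_div]
  · exact ⟨0, 0, Subring.zero_mem _, by simp⟩
  · exact ⟨0, 1, Subring.one_mem _, by simp⟩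
  · rintro a b - - ⟨m, s, hs, rfl⟩ ⟨n, s', hs', rfl⟩
    refine ⟨m + n, s * x ^ n + s' * x ^ m,
      Subring.add_mem _ (Subring.mul_mem _ hs (Subring.pow_mem _ hx n))
        (Subring.mul_mem _ hs' (Subring.pow_mem _ hx m)), ?_⟩
    have hxm : x ^ m ≠ 0 := pow_ne_zero m hx0
    have hxn : x ^ n ≠ 0 := pow_ne_zero n hx0
    field_simp
    ring
  · rintro a - ⟨m, s, hs, rfl⟩
    exact ⟨m, -s, Subring.neg_mem _ hs, by rw [neg_div]⟩
  · rintro a b - - ⟨m, s, hs, rfl⟩ ⟨n, s', hs', rfl⟩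
    refine ⟨m + n, s * s', Subring.mul_mem _ hs hs', ?_⟩
    rw [pow_add, div_mul_div_comm]

/-- A near element is a UNIT of the Noetherian hull (`x ≠ 0`). OURS. [cite: HeinzerEtAl2015, Prop. 4.4] -/
theorem IsNear.isUnit_hullRing {R : ℕ → Subring K} {x a : K} (hx : x ≠ 0) (h : IsNear R x a) :
    IsUnit (⟨a, shannonExt_le_hullRing R x h.1⟩ : hullRing R x) := by
  rw [isUnit_subring_iff_inv_mem]
  exact ⟨h.2.1, noethHull_subset_hullRing R x (inv_mem_noethHull_of_isNear R x a hx h)⟩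

/-- Conversely, an element of `S ∖ {0}` whose inverse lies in the hull is near (`x ∈ S`, `x ≠ 0`). OURS.
[cite: HeinzerEtAl2015, Prop. 4.4] -/
theorem isNear_of_inv_mem_hullRing {R : ℕ → Subring K} {x a : K} (hx : x ∈ shannonExt R) (hx0 : x ≠ 0)
    (ha : a ∈ shannonExt R) (ha0 : a ≠ 0) (hinv : a⁻¹ ∈ hullRing R x) : IsNear R x a := by
  obtain ⟨m, s, hs, hs'⟩ := hullRing_le_noethHull R x hx hx0 hinv
  refine ⟨ha, ha0, m, s, hs, ?_⟩
  have hxm : x ^ m ≠ 0 := pow_ne_zero m hx0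
  rw [eq_div_iff hxm] at hs'
  rw [← hs', ← mul_assoc, mul_inv_cancel₀ ha0, one_mul]

/-- Monomial × unit presentations multiply when they share the parameter part `z`. OURS. [folklore] -/
theorem monomialUnitAt_mul_of_same_part (S : Subring K) [IsLocalRing S] {s : ℕ} (z : Fin s → S)
    (hz : IsRsopPart z) (m m' : Fin s → ℕ) (u u' : S) (hu : IsUnit u) (hu' : IsUnit u') (g g' : K)
    (hg : g = (∏ l, ((z l : S) : K) ^ m l) * (u : K)) (hg' : g' = (∏ l, ((z l : S) : K) ^ m' l) * (u' : K)) :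
    ∃ (n : Fin s → ℕ) (w : S), IsUnit w ∧ g * g' = (∏ l, ((z l : S) : K) ^ n l) * (w : K) ∧
      (∀ l, n l = m l + m' l) ∧ MonomialUnitAt S (g * g') := by
  classical
  have key : g * g' = (∏ l, ((z l : S) : K) ^ (m l + m' l)) * ((u * u' : S) : K) := by
    rw [hg, hg', Subring.coe_mul]
    simp only [pow_add, Finset.prod_mul_distrib]
    ring
  exact ⟨fun l => m l + m' l, u * u', hu.mul hu', key, fun _ => rfl, s, z, hz, _, u * u', hu.mul hu', key⟩

/-! ## §B Near monomial reach — PROVED (HLOST Prop. 4.4 made elementary) -/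

/-- **The engine**: along a sequence of quadratic transforms along `O` of local rings dominated by `O` and starting at
a regular local ring, if `x` is a one-element part of a regular system of parameters of SOME member `R i₁` and
`a, s ∈ S = ⋃ Rᵢ` satisfy `a · s = x ^ m`, then `a` is monomial × unit at some member: `x` is monomial × unit at `R i₁`,
hence at every later member (`exists_monomial_along` ∘ `stub_rsopMonomialStep`, HLOST Lemma 2.7), and a divisor of a
monomial × unit in a regular local ring is one (`exists_monomial_of_mul_eq`).  No switching, no archimedean
hypothesis, any rank. OURS. [cite: HeinzerEtAl2015, Prop. 4.4] [cite: HeinzerEtAl2015, Lemma 2.7] -/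
theorem exists_monomialUnitAt_of_mul_eq_pow (O : ValuationSubring K) (R : ℕ → Subring K)
    (hreg₀ : IsRegularLocalRing (R 0)) (hdom₀ : SubringDominates (R 0) O.toSubring)
    (hstep : ∀ i, IsQuadraticTransformAlong O (R i) (R (i + 1)))
    (i₁ : ℕ) (hloc : IsLocalRing (R i₁)) (z₀ : Fin 1 → R i₁) (hz₀ : IsRsopPart z₀)
    {a s : K} (ha : a ∈ shannonExt R) (hs : s ∈ shannonExt R) (m : ℕ)
    (hmul : a * s = ((z₀ 0 : R i₁) : K) ^ m) :
    ∃ (i : ℕ) (_ : IsLocalRing (R i)), MonomialUnitAt (R i) a := by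
  classical
  haveI hRreg : ∀ i, IsRegularLocalRing (R i) := isRegularLocalRing_sequence hreg₀ hstep
  have hRdom : ∀ i, SubringDominates (R i) O.toSubring := fun i => (sequence_dominates hdom₀ hstep i).1
  have hmono : Monotone R := sequence_monotone hstep
  obtain ⟨ia, haR⟩ := (mem_shannonExt_iff_of_monotone hmono a).mp ha
  obtain ⟨js, hsR⟩ := (mem_shannonExt_iff_of_monotone hmono s).mp hs
  -- `x = z₀ 0` is monomial × unit at `R i₁`, hence at `R (i₁ + (ia + js))`
  have hbase : ∃ (s : ℕ) (z : Fin s → R i₁), IsRsopPart z ∧ ∃ (e : Fin s → ℕ) (u : R i₁),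
      IsUnit u ∧ ((z₀ 0 : R i₁) : K) = (∏ l, ((z l : R i₁) : K) ^ e l) * (u : K) :=
    ⟨1, z₀, hz₀, fun _ => 1, 1, isUnit_one, by simp⟩
  obtain ⟨s', zN, hzN, eN, uN, huN, hxeq⟩ :=
    exists_monomial_along stub_rsopMonomialStep O R hstep hRdom i₁ ((z₀ 0 : R i₁) : K) hbase (ia + js)
  have haN : a ∈ R (i₁ + (ia + js)) := hmono (by omega) haR
  have hsN : s ∈ R (i₁ + (ia + js)) := hmono (by omega) hsR
  -- `a * s = x ^ m` is a monomial × unit there, hence so is `a`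
  have hprod : a * s = (∏ l, ((zN l : R (i₁ + (ia + js))) : K) ^ (m * eN l)) *
      ((uN ^ m : R (i₁ + (ia + js))) : K) := by
    rw [hmul, hxeq, mul_pow, ← Finset.prod_pow, SubmonoidClass.coe_pow]
    refine congrArg (· * _) (Finset.prod_congr rfl fun l _ => ?_)
    rw [← pow_mul, mul_comm]
  obtain ⟨m', u', hu', ham⟩ := exists_monomial_of_mul_eq hzN (fun l => m * eN l) haN hsN (huN.pow m) hprod
  exact ⟨i₁ + (ia + js), inferInstance, s', zN, hzN, m', u', hu', ham⟩

/-- **K-B0′-near · `NearMonomialReach` IS CLOSED** (SUPPORT piece of res-L0-w41-idea-2's card 3; kernel — the tree's E-1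
engine with near-ness in place of strong switching): a NEAR element of the Shannon extension of the point sequence of a
base regular at the centre of `O` is MONOMIAL × UNIT at some member.  The TYPE of this theorem is the literal body of the
sketch's `def Idea2g4.NearMonomialReach : Prop` (Sketch-idea-2f l.654; stated here as a theorem, not as a named `Prop`,
so that nothing parameterless is vendored under `Summits/`), hence the sketch's / the skeleton's `NearMonomialReach`
closes by `exact Hull.nearMonomialReach_holds`.  Same proof as `Idea2g4.nearMonomialReach_holds` (l.666), routed through
`exists_monomialUnitAt_of_mul_eq_pow`. OURS. [cite: HeinzerEtAl2015, Prop. 4.4] [cite: HeinzerEtAl2015, Lemma 2.7] -/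
theorem nearMonomialReach_holds :
    ∀ (k K : Type) [Field k] [Field K] [Algebra k K] (O : ValuationSubring K) (A₀ : Subalgebra k K)
      (h₀ : A₀.toSubring ≤ O.toSubring) (R : ℕ → Subring K) (x a : K), A₀.FG →
      IsRegularLocalRing (Localization.AtPrime (Ideal.comap (Subring.inclusion h₀) (IsLocalRing.maximalIdeal O))) →
      IsPointSequenceAlong O A₀ R → IsHullParameter O R x → IsNear R x a →
      ∃ (i : ℕ) (_ : IsLocalRing (R i)), MonomialUnitAt (R i) a := by
  intro k K _ _ _ O A₀ h₀ R x a _hfg hreg hseq hx hnear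
  have hreg₀ : IsRegularLocalRing (R 0) := by
    rw [hseq.1]
    exact (isRegularLocalRing_locAtCentre_iff h₀).mpr hreg
  have hdom₀ : SubringDominates (R 0) O.toSubring := by
    rw [hseq.1]
    exact subringDominates_locAtCentre h₀
  obtain ⟨⟨i₁, hloc, z₀, hz₀, hzx⟩, -⟩ := hx
  obtain ⟨haS, -, m, s, hsS, hmul⟩ := hnear
  rw [← hzx] at hmul
  exact exists_monomialUnitAt_of_mul_eq_pow O R hreg₀ hdom₀ hseq.2 i₁ hloc z₀ hz₀ haS hsS m hmul

/-- Unbundled form over the point-sequence vocabulary (no `A₀.FG`, which the proof never uses): a near element is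
monomial × unit at some member. OURS. [cite: HeinzerEtAl2015, Prop. 4.4] -/
theorem IsNear.exists_monomialUnitAt {O : ValuationSubring K} {A₀ : Subalgebra k K} (h₀ : A₀.toSubring ≤ O.toSubring)
    {R : ℕ → Subring K} {x a : K}
    (hreg : IsRegularLocalRing (Localization.AtPrime (Ideal.comap (Subring.inclusion h₀) (IsLocalRing.maximalIdeal O))))
    (hseq : IsPointSequenceAlong O A₀ R) (hx : IsHullParameter O R x) (hnear : IsNear R x a) :
    ∃ (i : ℕ) (_ : IsLocalRing (R i)), MonomialUnitAt (R i) a := by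
  have hreg₀ : IsRegularLocalRing (R 0) := hseq.isRegularLocalRing h₀ hreg 0
  have hdom₀ : SubringDominates (R 0) O.toSubring := (hseq.subringDominates h₀ 0).1
  obtain ⟨⟨i₁, hloc, z₀, hz₀, hzx⟩, -⟩ := hx
  obtain ⟨haS, -, m, s, hsS, hmul⟩ := hnear
  rw [← hzx] at hmul
  exact exists_monomialUnitAt_of_mul_eq_pow O R hreg₀ hdom₀ hseq.2 i₁ hloc z₀ hz₀ haS hsS m hmul

/-- Monomial × unit PERSISTS along the point sequence: if `a` is monomial × unit at `R i₀`, it is so at every later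
member `R (i₀ + d)` (iterate HLOST Lemma 2.7 = the tree's `stub_rsopMonomialStep`). OURS. [cite: HeinzerEtAl2015, Lemma 2.7] -/
theorem MonomialUnitAt.along {O : ValuationSubring K} {A₀ : Subalgebra k K} (h₀ : A₀.toSubring ≤ O.toSubring)
    {R : ℕ → Subring K}
    (hreg : IsRegularLocalRing (Localization.AtPrime (Ideal.comap (Subring.inclusion h₀) (IsLocalRing.maximalIdeal O))))
    (hseq : IsPointSequenceAlong O A₀ R) {i₀ : ℕ} {hloc : IsLocalRing (R i₀)} {a : K}
    (ha : @MonomialUnitAt K _ (R i₀) hloc a) (d : ℕ) :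
    ∃ _ : IsLocalRing (R (i₀ + d)), MonomialUnitAt (R (i₀ + d)) a := by
  classical
  haveI hRreg : ∀ i, IsRegularLocalRing (R i) := hseq.isRegularLocalRing h₀ hreg
  have hRdom : ∀ i, SubringDominates (R i) O.toSubring := fun i => (hseq.subringDominates h₀ i).1
  obtain ⟨s, z, hz, m, u, hu, hau⟩ := ha
  obtain ⟨s', zN, hzN, eN, uN, huN, haeq⟩ :=
    exists_monomial_along stub_rsopMonomialStep O R hseq.2 hRdom i₀ a ⟨s, z, hz, m, u, hu, hau⟩ d
  exact ⟨inferInstance, s', zN, hzN, eN, uN, huN, haeq⟩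

/-! ## §C Far-regular exit — PROVED -/

/-- **L6 · far-regular exit**: if `f = e · w` with `w` a one-element family completing the members `y` to a part of a
regular system of parameters and `e` a monomial in the `y` times a unit (the E-1 shape of a near element), then `f` is
TOROIDAL with exponent `1` on `w` (any `p ≠ 1`).  So `e(f) = 1` +
transversality exits on the point sequence itself.  Literal copy of `Idea2g4.farRegularExit` (Sketch-idea-2f l.904).
OURS. [folklore] -/
theorem farRegularExit (p : ℕ) (hp : p ≠ 1) (S : Subring K) [IsLocalRing S] (f e : K) (c : ℕ) (y : Fin c → S)
    (w : Fin 1 → S) (hrs : IsRsopPart (Fin.append y w)) (m : Fin c → ℕ) (u : S) (hu : IsUnit u)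
    (he : e = (∏ j, ((y j : S) : K) ^ m j) * (u : K)) (hf : f = e * ((w 0 : S) : K)) :
    ToroidalAt p S f := by
  refine ⟨c + 1, Fin.append y w, hrs, Fin.append m (fun _ => 1), ⟨Fin.natAdd c 0, ?_⟩, u, hu, ?_⟩
  · rw [Fin.append_right]
    intro h
    exact hp (Nat.dvd_one.mp h)
  · rw [hf, he, Fin.prod_univ_add]
    simp only [Fin.append_left, Fin.append_right, Fin.prod_univ_one, pow_one]
    ring

/-- The far-regular exit in `MonomialUnitAt` form (forgetting the exponent-`1` witness). OURS. [folklore] -/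
theorem monomialUnitAt_of_farRegular_shape (S : Subring K) [IsLocalRing S] (f e : K) (c : ℕ) (y : Fin c → S)
    (w : Fin 1 → S) (hrs : IsRsopPart (Fin.append y w)) (m : Fin c → ℕ) (u : S) (hu : IsUnit u)
    (he : e = (∏ j, ((y j : S) : K) ^ m j) * (u : K)) (hf : f = e * ((w 0 : S) : K)) :
    MonomialUnitAt S f :=
  monomialUnitAt_of_toroidalAt 2 S f (farRegularExit 2 (by decide) S f e c y w hrs m u hu he hf)

end Summit.ResolutionOfSingularities.ResolutionOfSingularities.Theorems.SwitchingDichotomy.Hull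

end
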